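import Summits.QuantumFields.YangMills.Theorems.BalabanUVNodesN22AtRecordOfStepRecursion

/-!
# BalabanUVNodes ∕ node N22 = NE9 — THE RECURSION AT THE TERM LEVEL: pub-balaban's ROAD 1 and dag-n22-a's SECOND-ORDER STEP RECURSION run BY NAME on node00-def-W1's
# COMPLEX (2.13) terms `termC S j X g φ` through the RE-TWIST DEVICE, giving the TERM-LEVEL second-difference letter with constants GROWING like `ν^{age}` (J45∕J49's `hΔ`)
# from three TERM-LEVEL step schemas — NO smallness of the recursion's growth `ω₁ + c`

Cell `pub-ymgap`, HUMAN RULING D-0062 (Track A), R134 seat `pub-ymgap-dag-n22-c` (strategy s1), generation 17, module J51.  THEOREMS ONLY (no `def`, no `sorry`, standard axioms);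
`--kind proof --supports stmt-QuantumFields-27366 --as helper` (K3⁸ `SpineGivenEndpointR13SepCoPHV`), COUNT-NEUTRAL.  Imports module J50 `…N22AtRecordOfStepRecursion` (through it
pub-balaban's `T4HistoryLipschitzRecursion` — `StepLipschitz`, `ne9_of_stepLipschitz`, `renewalSuper_geometric`, `prodModuli` —, `T4CouplingAnalyticity.coordLipschitzOn_of_ne9`,
dag-n22-a's `N22KnitRecursion.secondDiff_of_stepSecondDiff`, node00-def-W1's `HistoryTermsOfRecord` — `ClusterTower`, `termC`, `histCarriers`, `box` — and J38's `update_mem_window`).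
Nothing re-declared; every step is plain application.

WHY (module J50's census, trigger (t24)).  J50 displayed the step inequalities of the renormalization recursion ON THE LIMITING KERNELS OF RECORD; a producer derives them from
TERM-level schemas through W1-20's law, the windows and (1.21).  Its census parked the term-level edition on a DESIGN obstacle: the abstract knits are REAL-valued
(`T4OutputRate.Functional C Bg = (ℕ → ℝ) → Bg → C.Dom → ℝ`) while the (2.13) term `E^{(j)}(X; g; (𝐔,𝐉)) = termC S j X g φ ∈ ℂ` is COMPLEX at the complex configurations of the
space tables, where J45∕J46∕J49's letters live (norm bounds).  THE REPAIR (§1): for `‖u‖ ≤ 1`, `|Re(u·z)| ≤ ‖z‖`, with EQUALITY at `u = conj z ∕ ‖z‖`; so a norm bound on any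
ℂ-linear combination of term values is EQUIVALENT to the family of real bounds on `Re(u·(combination))`, `u` in the closed unit disc.  Read the tower `S` as the REAL functional
**`E♯ g (u, φ) ⟨j, X⟩ := Re(u · termC S j X g (π φ))`** on def-W1's carriers `histCarriers P M p` with background type (closed unit disc of ℂ) × `CPair P 𝔸` (`π` = a projection onto
the space table, identity on it — §2 `exists_proj`): every NORM schema ∕ letter on the terms transfers to the `∀ u` schema ∕ letter on `E♯` and back (§2), and the abstract real
theorems apply verbatim (§3):
* §1 the device: `abs_re_mul_le_norm`, `norm_le_of_forall_abs_re_mul_le`, two linearity identities.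
* §2 transfers for any `E♯` of the displayed form: (P) prefix dependence (def-W1's `termC_congr_prefix` — BY TYPING), `ScaleZeroFree` (`termC S 0 = 0`), (T1) ⟹ `StepLipschitz E♯`,
  (T2-last) ⟹ (S2-last), (T2-old) ⟹ (S2-old), and the two norm extractions.
* §3 ★★ `termNE9_of_termStepLipschitz` — ROAD 1 AT THE TERM LEVEL, NO SMALLNESS: (T1) with `lam ≤ ℓ₁`, `a k j ≤ c·ω₁^{k−j}` ⟹
  `‖E^{(k+1)}(X; g; φ) − E^{(k+1)}(X; g′; φ)‖ ≤ e^{−κ d_{k+1}(X)}·Σ_{i ≤ k} ℓ₁(ω₁ + c)^{k−i}|g_i − g′_i|` on the space tables (`ne9_of_stepLipschitz` ∘ `renewalSuper_geometric` on `E♯`).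
  ★★ `termSecondDiff_of_termStepRecursion` — (T1) + (T2-last) (`lam₂ ≤ ℓ₂`) + (T2-old) with channel weights `0 ≤ a k j ≤ c·ω₁^{k−j}`, `0 ≤ b k j ≤ c_b·ω₁^{k−j}`, any `ν > ω₁ + c` with
  `ν ≥ (ω₁ + c)²` ⟹ THE TERM-LEVEL SECOND-DIFFERENCE LETTER **`‖E^{(k+1)}(X; g∣g_i:=t+d) − 2E^{(k+1)}(X; g∣g_i:=t) + E^{(k+1)}(X; g∣g_i:=t−d)‖ ≤ L₂·ν^{k−i}·e^{−κ d_{k+1}(X)}·d²`**,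
  `L₂ = max ℓ₂ (c_b ℓ₁²∕(ν − ω₁ − c))` — dag-n22-a's `secondDiff_of_stepSecondDiff` on `E♯` with (L1) from ROAD 1 (`coordLipschitzOn_of_ne9`), then §2's extraction.
  ★★ `termSecondDiffAt_box_of_termStepRecursion` — the same in the BOX-HISTORY shape of J45∕J48∕J49's `hΔ` literally (`(S k).E (update g i ·) φ X`, `g ∈ box γ k`, `i : Fin (k+1)`,
  table `L₂·ν^{k−i}`): module J52 feeds it to J49 §2 at every torus.
THE TERM-LEVEL SCHEMAS (displayed hypotheses, norm form, one tower `S : ClusterTower P 𝔸 M`, space table `sp k X ⊆ CPair P 𝔸` at the levels `k + 1`, histories of `Window γ`):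
(T1) for a majorant `D` of the decay-weighted differences of the terms of levels `1, …, k` at all admissible configurations, the level-`(k+1)` term differs by at most
`e^{−κd}(lam k·|g_k − g′_k| + Σ_{j≤k} a k j·D j)` — pub-balaban's `StepLipschitz` read on the terms ([I] (2.12)–(2.13) p. 268: the explicit last coupling and the curly bracket);
(T2-last) second differences in the LAST coupling `≤ lam₂ k·d²·e^{−κd}`; (T2-old) dag-n22-a's second-order step inequality (linear channel `a` on second differences of the old terms,
variance channel `b` on squares of their first differences).  Cell NEW-ESTIMATE SHAPES, NOT PRINTED (GAPS G-t4-U3-1∕-3); print has the recursion (0.23) p. 256, (2.12)–(2.13) p. 268,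
the last-coupling C^∞ clause p. 263 without constants, and «depends also on all preceding coupling constants» p. 298.  Inhabited by every history-free tower (A5: content = the
composition's shape, conditional); a producer is node N10 ∕ NODE A ∕ def-W1's generator (`HistoryRecursionOfRecord.GenTower`).

HONEST FRAMING (binding).  Count-neutral COMPOSITION of landed theorems by name plus one elementary device (§1, Mathlib-only content); NO estimate of Bałaban's is proved or asserted;
nothing of the record is constructed or claimed to meet the displayed schemas; the coefficient algebra `𝔸` is taken in `Type` (the universe of `T4OutputRate.Carriers`' background
types).  N22 is NOT discharged (typed 28∕28 · discharged 5∕27 UNCHANGED); K3⁸ OPEN and NOT claimed (no stub of 27366 touched); NE9 is NOT IN PRINT for d = 4; no count claim; one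
finite 𝕋⁴ programme at fixed ε — R4 closes the CONDITIONAL rung `BalabanLadder.UV` only; NOTHING about the continuum limit, ℝ⁴, infinite volume, OS axioms, a mass gap or the Clay
problem is proved or claimed.  References (TYPES only): [I] = Bałaban, CMP 109 (1987) (0.23) p. 256, §1 p. 263, (2.12)–(2.13) p. 268, §5 p. 298; [II] = CMP 116 (1988) (2.13)–(2.14) pp. 14–15.
-/

noncomputable section

open Set Metric
open scoped BigOperators ComplexConjugate

namespace YMDAG.N22.TermRecursion

open Literature.MathematicalPhysics.QuantumFieldTheory.Balaban1983to89
open Literature.MathematicalPhysics.QuantumFieldTheory.Balaban1983to89.T4OutputRate (Carriers Functional Window NE9 PrefixDependenceOn)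
open Literature.MathematicalPhysics.QuantumFieldTheory.Balaban1983to89.T4HistoryLipschitzRecursion (ScaleZeroFree StepLipschitz ne9_of_stepLipschitz renewalSuper_geometric prodModuli prodModuli_const)
open Literature.MathematicalPhysics.QuantumFieldTheory.Balaban1983to89.T4CouplingAnalyticity (BoxWindow coordLipschitzOn_of_ne9)
open Literature.MathematicalPhysics.QuantumFieldTheory.Balaban1983to89.Node00.Sect2 (domSys CPair)
open Literature.MathematicalPhysics.QuantumFieldTheory.Balaban1983to89.Node00.W1
open Summit.QuantumFields.YangMills.BalabanUVNodes.N22KnitRecursion (secondDiff_of_stepSecondDiff)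
open YMDAG.N22.KernelFading (update_mem_window)
open YMDAG.N22.WindowedSecondDiff (histPrefix_update)

/-! ## §1 The re-twist device: norm bounds on `ℂ` ⟺ real bounds on `Re(u·z)`, `‖u‖ ≤ 1` -/
/-- For `‖u‖ ≤ 1`: `|Re(u·z)| ≤ ‖z‖`. [folklore] -/
theorem abs_re_mul_le_norm {u : ℂ} (z : ℂ) (hu : ‖u‖ ≤ 1) : |(u * z).re| ≤ ‖z‖ := by
  refine (Complex.abs_re_le_norm _).trans ?_
  rw [norm_mul]
  exact mul_le_of_le_one_left (norm_nonneg _) hu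

/-- THE EXTRACTION: if `|Re(u·z)| ≤ B` for every `u` of the closed unit disc, then `‖z‖ ≤ B` (test `u = conj z ∕ ‖z‖`, or `u = 0` when `z = 0`). [folklore] -/
theorem norm_le_of_forall_abs_re_mul_le {z : ℂ} {B : ℝ} (h : ∀ u : ℂ, ‖u‖ ≤ 1 → |(u * z).re| ≤ B) : ‖z‖ ≤ B := by
  by_cases hz : z = 0
  · simpa [hz] using h 0 (by simp)
  · have hn : 0 < ‖z‖ := norm_pos_iff.mpr hz
    have hu : ‖conj z / (‖z‖ : ℂ)‖ ≤ 1 := by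
      rw [norm_div, Complex.norm_conj, Complex.norm_real, Real.norm_of_nonneg hn.le, div_self hn.ne']
    have key := h _ hu
    have e : (conj z / (‖z‖ : ℂ) * z).re = ‖z‖ := by
      rw [div_mul_eq_mul_div, Complex.conj_mul', ← Complex.ofReal_pow, ← Complex.ofReal_div, Complex.ofReal_re, sq, mul_div_assoc,
        div_self hn.ne', mul_one]
    rwa [e, abs_of_pos hn] at key

/-- Linearity of the twist, first differences: `Re(u a) − Re(u b) = Re(u (a − b))`. [folklore] -/
theorem re_mul_sub (u a b : ℂ) : (u * a).re - (u * b).re = (u * (a - b)).re := by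
  rw [mul_sub, Complex.sub_re]

/-- Linearity of the twist, second differences: `Re(u a) − 2Re(u b) + Re(u c) = Re(u (a − 2b + c))`. [folklore] -/
theorem re_mul_secondDiff (u a b c : ℂ) : (u * a).re - 2 * (u * b).re + (u * c).re = (u * (a - 2 * b + c)).re := by
  rw [show u * (a - 2 * b + c) = u * a - (2 : ℝ) * (u * b) + u * c by push_cast; ring, Complex.add_re, Complex.sub_re, Complex.re_ofReal_mul]

/-! ## §2 The re-twisted functional of a tower and the transfers (one tower `S : ClusterTower P 𝔸 M`, background type = closed unit disc × `CPair P 𝔸`) -/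
section Transfer

variable {P : Params} {𝔸 : Type} {M : ℕ} (S : ClusterTower P 𝔸 M) (p : RunPairing)
  (sp : (k : ℕ) → (domSys P M (k + 1)).Dom → Set (CPair P 𝔸))
  (π : Node00.W1.Dom P M → CPair P 𝔸 → CPair P 𝔸)
  (E : Functional (histCarriers P M p) (closedBall (0 : ℂ) 1 × CPair P 𝔸))

open Classical in
/-- A PROJECTION ONTO THE SPACE TABLE: for a table non-empty at every point of the levels `k + 1` there is `π` with `π ⟨k+1, X⟩ φ ∈ sp k X` always and `= φ` for `φ ∈ sp k X`
(identity at level `0`, where no term lives). [folklore] -/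
theorem exists_proj (hsp : ∀ k X, (sp k X).Nonempty) :
    ∃ π : Node00.W1.Dom P M → CPair P 𝔸 → CPair P 𝔸, (∀ (k : ℕ) (X : (domSys P M (k + 1)).Dom) (φ : CPair P 𝔸), π ⟨k + 1, X⟩ φ ∈ sp k X) ∧
      ∀ (k : ℕ) (X : (domSys P M (k + 1)).Dom), ∀ φ ∈ sp k X, π ⟨k + 1, X⟩ φ = φ := by
  refine ⟨fun X => Nat.rec (motive := fun j => (domSys P M j).Dom → CPair P 𝔸 → CPair P 𝔸) (fun _ φ => φ)
    (fun k _ X' φ => if φ ∈ sp k X' then φ else (hsp k X').some) X.1 X.2, fun k X φ => ?_, fun k X φ hφ => ?_⟩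
  · show (if φ ∈ sp k X then φ else (hsp k X).some) ∈ sp k X
    split_ifs with h; exacts [h, (hsp k X).some_mem]
  · show (if φ ∈ sp k X then φ else (hsp k X).some) = φ
    rw [if_pos hφ]

/-- First differences of `E♯` are dominated by the norm of the term difference at the projected configuration. [folklore] -/
theorem abs_sub_reTwist_le (hE : ∀ g U X, E g U X = ((U.1 : ℂ) * termC S X.1 X.2 g (π X U.2)).re) (g g' : ℕ → ℝ)
    (U : closedBall (0 : ℂ) 1 × CPair P 𝔸) (X : Node00.W1.Dom P M) :
    |E g U X - E g' U X| ≤ ‖termC S X.1 X.2 g (π X U.2) - termC S X.1 X.2 g' (π X U.2)‖ := by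
  rw [hE, hE, re_mul_sub]
  exact abs_re_mul_le_norm _ (mem_closedBall_zero_iff.mp U.1.2)

/-- Second differences of `E♯` are dominated by the norm of the term second difference at the projected configuration. [folklore] -/
theorem abs_secondDiff_reTwist_le (hE : ∀ g U X, E g U X = ((U.1 : ℂ) * termC S X.1 X.2 g (π X U.2)).re) (g₁ g₂ g₃ : ℕ → ℝ)
    (U : closedBall (0 : ℂ) 1 × CPair P 𝔸) (X : Node00.W1.Dom P M) :
    |E g₁ U X - 2 * E g₂ U X + E g₃ U X| ≤ ‖termC S X.1 X.2 g₁ (π X U.2) - 2 * termC S X.1 X.2 g₂ (π X U.2) + termC S X.1 X.2 g₃ (π X U.2)‖ := by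
  rw [hE, hE, hE, re_mul_secondDiff]
  exact abs_re_mul_le_norm _ (mem_closedBall_zero_iff.mp U.1.2)

/-- EXTRACTION, first differences: a bound on `|E♯ g (u,φ) ⟨k+1,X⟩ − E♯ g′ (u,φ) ⟨k+1,X⟩|` for every `u` of the disc at an admissible `φ` IS the norm bound. [folklore] -/
theorem norm_sub_termC_le_of_reTwist (hE : ∀ g U X, E g U X = ((U.1 : ℂ) * termC S X.1 X.2 g (π X U.2)).re)
    (hπid : ∀ (k : ℕ) (X : (domSys P M (k + 1)).Dom), ∀ φ ∈ sp k X, π ⟨k + 1, X⟩ φ = φ)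
    {g g' : ℕ → ℝ} {k : ℕ} {X : (domSys P M (k + 1)).Dom} {φ : CPair P 𝔸} (hφ : φ ∈ sp k X) {B : ℝ}
    (h : ∀ u : closedBall (0 : ℂ) 1, |E g (u, φ) ⟨k + 1, X⟩ - E g' (u, φ) ⟨k + 1, X⟩| ≤ B) :
    ‖termC S (k + 1) X g φ - termC S (k + 1) X g' φ‖ ≤ B := by
  refine norm_le_of_forall_abs_re_mul_le fun u hu => ?_
  have h' := h ⟨u, mem_closedBall_zero_iff.mpr hu⟩
  rwa [hE, hE, re_mul_sub, hπid k X φ hφ] at h'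

/-- EXTRACTION, second differences. [folklore] -/
theorem norm_secondDiff_termC_le_of_reTwist (hE : ∀ g U X, E g U X = ((U.1 : ℂ) * termC S X.1 X.2 g (π X U.2)).re)
    (hπid : ∀ (k : ℕ) (X : (domSys P M (k + 1)).Dom), ∀ φ ∈ sp k X, π ⟨k + 1, X⟩ φ = φ)
    {g₁ g₂ g₃ : ℕ → ℝ} {k : ℕ} {X : (domSys P M (k + 1)).Dom} {φ : CPair P 𝔸} (hφ : φ ∈ sp k X) {B : ℝ}
    (h : ∀ u : closedBall (0 : ℂ) 1, |E g₁ (u, φ) ⟨k + 1, X⟩ - 2 * E g₂ (u, φ) ⟨k + 1, X⟩ + E g₃ (u, φ) ⟨k + 1, X⟩| ≤ B) :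
    ‖termC S (k + 1) X g₁ φ - 2 * termC S (k + 1) X g₂ φ + termC S (k + 1) X g₃ φ‖ ≤ B := by
  refine norm_le_of_forall_abs_re_mul_le fun u hu => ?_
  have h' := h ⟨u, mem_closedBall_zero_iff.mpr hu⟩
  rwa [hE, hE, hE, re_mul_secondDiff, hπid k X φ hφ] at h'

/-- (P) PREFIX DEPENDENCE of the re-twisted functional on any history set — BY TYPING (def-W1's `termC_congr_prefix`). [folklore] -/
theorem prefixDependenceOn_reTwist (hE : ∀ g U X, E g U X = ((U.1 : ℂ) * termC S X.1 X.2 g (π X U.2)).re) (W : Set (ℕ → ℝ)) :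
    PrefixDependenceOn E W := by
  intro g _ g' _ U X h
  rw [hE, hE, termC_congr_prefix S X.1 X.2 h]

/-- `ScaleZeroFree` of the re-twisted functional — no term is created at step `0` (`termC S 0 = 0`). [folklore] -/
theorem scaleZeroFree_reTwist (hE : ∀ g U X, E g U X = ((U.1 : ℂ) * termC S X.1 X.2 g (π X U.2)).re) (W : Set (ℕ → ℝ)) :
    ScaleZeroFree E W := by
  intro g _ g' _ U X hX
  obtain ⟨j, X⟩ := X
  change j = 0 at hX
  subst hX
  rw [hE, hE, termC_zero, termC_zero]

open Finset in
/-- **(T1) ⟹ `StepLipschitz E♯`.**  The TERM-LEVEL first-order step schema in norm form (majorant `D` of the decay-weighted differences of the terms of levels `1, …, k` at all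
admissible configurations ⟹ the level-`(k+1)` term differs by at most `e^{−κd}(lam k·|g_k − g′_k| + Σ_{j≤k} a k j·D j)`) gives pub-balaban's `StepLipschitz` for the re-twisted
functional (antecedent extracted with §1, conclusion read at the projected configuration). [folklore] -/
theorem stepLipschitz_reTwist_of_term (hE : ∀ g U X, E g U X = ((U.1 : ℂ) * termC S X.1 X.2 g (π X U.2)).re)
    (hπ : ∀ (k : ℕ) (X : (domSys P M (k + 1)).Dom) (φ : CPair P 𝔸), π ⟨k + 1, X⟩ φ ∈ sp k X)
    (hπid : ∀ (k : ℕ) (X : (domSys P M (k + 1)).Dom), ∀ φ ∈ sp k X, π ⟨k + 1, X⟩ φ = φ)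
    {W : Set (ℕ → ℝ)} {κ : ℝ} {lam : ℕ → ℝ} {a : ℕ → ℕ → ℝ}
    (hT1 : ∀ g ∈ W, ∀ g' ∈ W, ∀ (D : ℕ → ℝ) (k : ℕ),
      (∀ k' < k, ∀ (X' : (domSys P M (k' + 1)).Dom), ∀ φ' ∈ sp k' X',
        ‖termC S (k' + 1) X' g φ' - termC S (k' + 1) X' g' φ'‖ ≤ Real.exp (-(κ * (domSys P M (k' + 1)).dj X')) * D (k' + 1)) →
      ∀ (X : (domSys P M (k + 1)).Dom), ∀ φ ∈ sp k X,
        ‖termC S (k + 1) X g φ - termC S (k + 1) X g' φ‖ ≤ Real.exp (-(κ * (domSys P M (k + 1)).dj X)) * (lam k * |g k - g' k| + ∑ j ∈ range (k + 1), a k j * D j)) :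
    StepLipschitz E W κ lam a := by
  intro g hg g' hg' D k hold U X hX
  obtain ⟨j, X⟩ := X
  change j = k + 1 at hX
  subst hX
  refine (abs_sub_reTwist_le S p π E hE g g' U ⟨k + 1, X⟩).trans ?_
  refine hT1 g hg g' hg' D k (fun k' hk' X' φ' hφ' => ?_) X (π ⟨k + 1, X⟩ U.2) (hπ k X U.2)
  exact norm_sub_termC_le_of_reTwist S p sp π E hE hπid hφ' fun u => hold (u, φ') ⟨k' + 1, X'⟩ (by change k' + 1 ≤ k; omega)

/-- **(T2-last) ⟹ (S2-last) for `E♯`**: second differences of the level-`(k+1)` term in its LAST coupling `≤ lam₂ k·d²·e^{−κd}` at admissible configurations. [folklore] -/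
theorem secondDiffLast_reTwist_of_term (hE : ∀ g U X, E g U X = ((U.1 : ℂ) * termC S X.1 X.2 g (π X U.2)).re)
    (hπ : ∀ (k : ℕ) (X : (domSys P M (k + 1)).Dom) (φ : CPair P 𝔸), π ⟨k + 1, X⟩ φ ∈ sp k X)
    {γ κ : ℝ} {lam₂ : ℕ → ℝ}
    (hT2last : ∀ g ∈ Window γ, ∀ (k : ℕ) (t d : ℝ), 0 < d → t - d ∈ Ioc (0 : ℝ) γ → t + d ∈ Ioc (0 : ℝ) γ →
      ∀ (X : (domSys P M (k + 1)).Dom), ∀ φ ∈ sp k X,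
        ‖termC S (k + 1) X (Function.update g k (t + d)) φ - 2 * termC S (k + 1) X (Function.update g k t) φ +
            termC S (k + 1) X (Function.update g k (t - d)) φ‖ ≤ Real.exp (-(κ * (domSys P M (k + 1)).dj X)) * (lam₂ k * d ^ 2)) :
    ∀ g ∈ Window γ, ∀ (k : ℕ) (t d : ℝ), 0 < d → t - d ∈ Ioc (0 : ℝ) γ → t + d ∈ Ioc (0 : ℝ) γ →
      ∀ (U : closedBall (0 : ℂ) 1 × CPair P 𝔸) (X : (histCarriers P M p).Dom), (histCarriers P M p).scale X = k + 1 →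
        |E (Function.update g k (t + d)) U X - 2 * E (Function.update g k t) U X + E (Function.update g k (t - d)) U X| ≤
          Real.exp (-(κ * (histCarriers P M p).d X)) * (lam₂ k * d ^ 2) := by
  intro g hg k t d hd hm hp U X hX
  obtain ⟨j, X⟩ := X
  change j = k + 1 at hX
  subst hX
  exact (abs_secondDiff_reTwist_le S p π E hE _ _ _ U ⟨k + 1, X⟩).trans (hT2last g hg k t d hd hm hp X _ (hπ k X U.2))

open Finset in
/-- **(T2-old) ⟹ (S2-old) for `E♯`.**  dag-n22-a's SECOND-ORDER STEP INEQUALITY in norm form at the term level (older coupling `g_i`, `i < k`: given first ∕ second difference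
profiles `D₁`, `D₂` of the terms of levels `1, …, k` at all admissible configurations, the level-`(k+1)` term's second difference is `≤ e^{−κd}·Σ_{j≤k}(a k j·D₂ j + b k j·(D₁ j)²)`)
gives (S2-old) for the re-twisted functional. [folklore] -/
theorem secondDiffOld_reTwist_of_term (hE : ∀ g U X, E g U X = ((U.1 : ℂ) * termC S X.1 X.2 g (π X U.2)).re)
    (hπ : ∀ (k : ℕ) (X : (domSys P M (k + 1)).Dom) (φ : CPair P 𝔸), π ⟨k + 1, X⟩ φ ∈ sp k X)
    (hπid : ∀ (k : ℕ) (X : (domSys P M (k + 1)).Dom), ∀ φ ∈ sp k X, π ⟨k + 1, X⟩ φ = φ)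
    {γ κ : ℝ} {a b : ℕ → ℕ → ℝ}
    (hT2old : ∀ g ∈ Window γ, ∀ (i : ℕ) (t d : ℝ), 0 < d → t - d ∈ Ioc (0 : ℝ) γ → t + d ∈ Ioc (0 : ℝ) γ →
      ∀ (D₁ D₂ : ℕ → ℝ) (k : ℕ), i < k →
        (∀ k' < k, ∀ (X' : (domSys P M (k' + 1)).Dom), ∀ φ' ∈ sp k' X',
          ‖termC S (k' + 1) X' (Function.update g i (t + d)) φ' - termC S (k' + 1) X' (Function.update g i t) φ'‖ ≤
              Real.exp (-(κ * (domSys P M (k' + 1)).dj X')) * D₁ (k' + 1) ∧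
          ‖termC S (k' + 1) X' (Function.update g i t) φ' - termC S (k' + 1) X' (Function.update g i (t - d)) φ'‖ ≤
              Real.exp (-(κ * (domSys P M (k' + 1)).dj X')) * D₁ (k' + 1) ∧
          ‖termC S (k' + 1) X' (Function.update g i (t + d)) φ' - 2 * termC S (k' + 1) X' (Function.update g i t) φ' +
              termC S (k' + 1) X' (Function.update g i (t - d)) φ'‖ ≤ Real.exp (-(κ * (domSys P M (k' + 1)).dj X')) * D₂ (k' + 1)) →
        ∀ (X : (domSys P M (k + 1)).Dom), ∀ φ ∈ sp k X,
          ‖termC S (k + 1) X (Function.update g i (t + d)) φ - 2 * termC S (k + 1) X (Function.update g i t) φ +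
              termC S (k + 1) X (Function.update g i (t - d)) φ‖ ≤
            Real.exp (-(κ * (domSys P M (k + 1)).dj X)) * ∑ j ∈ range (k + 1), (a k j * D₂ j + b k j * D₁ j ^ 2)) :
    ∀ g ∈ Window γ, ∀ (i : ℕ) (t d : ℝ), 0 < d → t - d ∈ Ioc (0 : ℝ) γ → t + d ∈ Ioc (0 : ℝ) γ →
      ∀ (D₁ D₂ : ℕ → ℝ) (k : ℕ), i < k →
        (∀ (U' : closedBall (0 : ℂ) 1 × CPair P 𝔸) (X' : (histCarriers P M p).Dom), (histCarriers P M p).scale X' ≤ k →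
          |E (Function.update g i (t + d)) U' X' - E (Function.update g i t) U' X'| ≤ Real.exp (-(κ * (histCarriers P M p).d X')) * D₁ ((histCarriers P M p).scale X') ∧
          |E (Function.update g i t) U' X' - E (Function.update g i (t - d)) U' X'| ≤ Real.exp (-(κ * (histCarriers P M p).d X')) * D₁ ((histCarriers P M p).scale X') ∧
          |E (Function.update g i (t + d)) U' X' - 2 * E (Function.update g i t) U' X' + E (Function.update g i (t - d)) U' X'| ≤
            Real.exp (-(κ * (histCarriers P M p).d X')) * D₂ ((histCarriers P M p).scale X')) →
        ∀ (U : closedBall (0 : ℂ) 1 × CPair P 𝔸) (X : (histCarriers P M p).Dom), (histCarriers P M p).scale X = k + 1 →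
          |E (Function.update g i (t + d)) U X - 2 * E (Function.update g i t) U X + E (Function.update g i (t - d)) U X| ≤
            Real.exp (-(κ * (histCarriers P M p).d X)) * ∑ j ∈ range (k + 1), (a k j * D₂ j + b k j * D₁ j ^ 2) := by
  intro g hg i t d hd hm hp' D₁ D₂ k hik hold U X hX
  obtain ⟨j, X⟩ := X
  change j = k + 1 at hX
  subst hX
  refine (abs_secondDiff_reTwist_le S p π E hE _ _ _ U ⟨k + 1, X⟩).trans ?_
  refine hT2old g hg i t d hd hm hp' D₁ D₂ k hik (fun k' hk' X' φ' hφ' => ⟨?_, ?_, ?_⟩) X (π ⟨k + 1, X⟩ U.2) (hπ k X U.2)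
  · exact norm_sub_termC_le_of_reTwist S p sp π E hE hπid hφ' fun u => (hold (u, φ') ⟨k' + 1, X'⟩ (by change k' + 1 ≤ k; omega)).1
  · exact norm_sub_termC_le_of_reTwist S p sp π E hE hπid hφ' fun u => (hold (u, φ') ⟨k' + 1, X'⟩ (by change k' + 1 ≤ k; omega)).2.1
  · exact norm_secondDiff_termC_le_of_reTwist S p sp π E hE hπid hφ' fun u => (hold (u, φ') ⟨k' + 1, X'⟩ (by change k' + 1 ≤ k; omega)).2.2

end Transfer

/-! ## §3 ★★ ROAD 1 and the second-order recursion AT THE TERM LEVEL — the norm letters on the (2.13) terms, NO smallness -/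
section Term

variable {P : Params} {𝔸 : Type} {M : ℕ} (S : ClusterTower P 𝔸 M) (sp : (k : ℕ) → (domSys P M (k + 1)).Dom → Set (CPair P 𝔸))

open Finset in
/-- ★★ **ROAD 1 AT THE TERM LEVEL, NO SMALLNESS.**  On one tower `S` with a space table `sp` non-empty at every point: the term-level first-order step schema (T1) on the window
`]0, γ]^ℕ` with `lam ≤ ℓ₁` (`ℓ₁ ≥ 0`) and channel weights `a k j ≤ c·ω₁^{k−j}` (`c, ω₁ ≥ 0`) ⟹ for all window histories `g, g′`, every level `k + 1`, domain `X` and admissible `φ`: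
**`‖E^{(k+1)}(X; g; φ) − E^{(k+1)}(X; g′; φ)‖ ≤ e^{−κ d_{k+1}(X)}·Σ_{i ≤ k} ℓ₁(ω₁ + c)^{k−i}|g_i − g′_i|`** — pub-balaban's `ne9_of_stepLipschitz` ∘ `renewalSuper_geometric` on the
re-twisted functional, read back in norm by §1.  The moduli FADE only if `ω₁ + c < 1` (clause N2 — not assumed). [folklore] -/
theorem termNE9_of_termStepLipschitz (hsp : ∀ k X, (sp k X).Nonempty) {γ κ ℓ₁ c ω₁ : ℝ} {lam : ℕ → ℝ} {a : ℕ → ℕ → ℝ}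
    (hT1 : ∀ g ∈ Window γ, ∀ g' ∈ Window γ, ∀ (D : ℕ → ℝ) (k : ℕ),
      (∀ k' < k, ∀ (X' : (domSys P M (k' + 1)).Dom), ∀ φ' ∈ sp k' X',
        ‖termC S (k' + 1) X' g φ' - termC S (k' + 1) X' g' φ'‖ ≤ Real.exp (-(κ * (domSys P M (k' + 1)).dj X')) * D (k' + 1)) →
      ∀ (X : (domSys P M (k + 1)).Dom), ∀ φ ∈ sp k X,
        ‖termC S (k + 1) X g φ - termC S (k + 1) X g' φ‖ ≤ Real.exp (-(κ * (domSys P M (k + 1)).dj X)) * (lam k * |g k - g' k| + ∑ j ∈ range (k + 1), a k j * D j))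
    (hlam : ∀ k, lam k ≤ ℓ₁) (hℓ₁ : 0 ≤ ℓ₁) (ha : ∀ k j, j ≤ k → a k j ≤ c * ω₁ ^ (k - j)) (hc : 0 ≤ c) (hω₁ : 0 ≤ ω₁) :
    ∀ g ∈ Window γ, ∀ g' ∈ Window γ, ∀ (k : ℕ) (X : (domSys P M (k + 1)).Dom), ∀ φ ∈ sp k X,
      ‖termC S (k + 1) X g φ - termC S (k + 1) X g' φ‖ ≤
        Real.exp (-(κ * (domSys P M (k + 1)).dj X)) * ∑ i ∈ range (k + 1), ℓ₁ * (ω₁ + c) ^ (k - i) * |g i - g' i| := by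
  obtain ⟨π, hπ, hπid⟩ := exists_proj sp hsp
  set E : Functional (histCarriers P M (RunPairing.single Unit)) (closedBall (0 : ℂ) 1 × CPair P 𝔸) :=
    fun g U X => ((U.1 : ℂ) * termC S X.1 X.2 g (π X U.2)).re with hEdef
  have hE : ∀ g U X, E g U X = ((U.1 : ℂ) * termC S X.1 X.2 g (π X U.2)).re := fun _ _ _ => rfl
  have hNE : NE9 E (Window γ) κ (prodModuli ℓ₁ fun _ => ω₁ + c) :=
    ne9_of_stepLipschitz (scaleZeroFree_reTwist S _ π E hE _) (stepLipschitz_reTwist_of_term S _ sp π E hE hπ hπid hT1)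
      (renewalSuper_geometric hℓ₁ hc hω₁ hlam ha)
  intro g hg g' hg' k X φ hφ
  have h := norm_sub_termC_le_of_reTwist S _ sp π E hE hπid hφ fun u => hNE g hg g' hg' (u, φ) ⟨k + 1, X⟩
  refine h.trans (le_of_eq ?_)
  change Real.exp (-(κ * (domSys P M (k + 1)).dj X)) * ∑ i ∈ range (k + 1), prodModuli ℓ₁ (fun _ => ω₁ + c) (k + 1) i * |g i - g' i| = _
  refine congrArg _ (sum_congr rfl fun i hi => ?_)
  rw [prodModuli_const, if_pos (mem_range.mp hi), Nat.add_sub_cancel]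

open Finset in
/-- ★★ **THE TERM-LEVEL SECOND-DIFFERENCE LETTER WITH AGE-GROWING CONSTANTS FROM THE TERM-LEVEL RECURSION, NO SMALLNESS.**  On one tower `S` with a space table `sp` non-empty at
every point: (T1) with `lam ≤ ℓ₁`; (T2-last) with `lam₂ ≤ ℓ₂`; (T2-old) with channels `a`, `b`; weights `0 ≤ a k j ≤ c·ω₁^{k−j}`, `0 ≤ b k j ≤ c_b·ω₁^{k−j}`; a growth rate `ν` with
`ω₁ + c < ν`, `(ω₁ + c)² ≤ ν` ⟹ for every window history `g`, level `k + 1`, young coordinate `i ≤ k`, steps `t ± d ∈ ]0, γ]`, domain `X` and admissible `φ`: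
**`‖E^{(k+1)}(X; g∣g_i:=t+d; φ) − 2E^{(k+1)}(X; g∣g_i:=t; φ) + E^{(k+1)}(X; g∣g_i:=t−d; φ)‖ ≤ L₂·ν^{k−i}·e^{−κ d_{k+1}(X)}·d²`**, `L₂ = max ℓ₂ (c_b ℓ₁²∕(ν − ω₁ − c))` — dag-n22-a's
`N22KnitRecursion.secondDiff_of_stepSecondDiff` on the re-twisted functional, its (L1) supplied by ROAD 1 without smallness (`ne9_of_stepLipschitz` ∘ `renewalSuper_geometric` ∘
`coordLipschitzOn_of_ne9`, as in J50 §1), read back in norm by §1.  This is J45∕J49's term-level letter `hΔ` with the table `M₂ k i = L₂·ν^{k−i}`. [folklore] -/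
theorem termSecondDiff_of_termStepRecursion (hsp : ∀ k X, (sp k X).Nonempty) {γ κ ℓ₁ ℓ₂ c cb ω₁ ν : ℝ} {lam lam₂ : ℕ → ℝ} {a b : ℕ → ℕ → ℝ}
    (hT1 : ∀ g ∈ Window γ, ∀ g' ∈ Window γ, ∀ (D : ℕ → ℝ) (k : ℕ),
      (∀ k' < k, ∀ (X' : (domSys P M (k' + 1)).Dom), ∀ φ' ∈ sp k' X',
        ‖termC S (k' + 1) X' g φ' - termC S (k' + 1) X' g' φ'‖ ≤ Real.exp (-(κ * (domSys P M (k' + 1)).dj X')) * D (k' + 1)) →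
      ∀ (X : (domSys P M (k + 1)).Dom), ∀ φ ∈ sp k X,
        ‖termC S (k + 1) X g φ - termC S (k + 1) X g' φ‖ ≤ Real.exp (-(κ * (domSys P M (k + 1)).dj X)) * (lam k * |g k - g' k| + ∑ j ∈ range (k + 1), a k j * D j))
    (hlam : ∀ k, lam k ≤ ℓ₁) (hℓ₁ : 0 ≤ ℓ₁)
    (hT2last : ∀ g ∈ Window γ, ∀ (k : ℕ) (t d : ℝ), 0 < d → t - d ∈ Ioc (0 : ℝ) γ → t + d ∈ Ioc (0 : ℝ) γ →
      ∀ (X : (domSys P M (k + 1)).Dom), ∀ φ ∈ sp k X,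
        ‖termC S (k + 1) X (Function.update g k (t + d)) φ - 2 * termC S (k + 1) X (Function.update g k t) φ +
            termC S (k + 1) X (Function.update g k (t - d)) φ‖ ≤ Real.exp (-(κ * (domSys P M (k + 1)).dj X)) * (lam₂ k * d ^ 2))
    (hT2old : ∀ g ∈ Window γ, ∀ (i : ℕ) (t d : ℝ), 0 < d → t - d ∈ Ioc (0 : ℝ) γ → t + d ∈ Ioc (0 : ℝ) γ →
      ∀ (D₁ D₂ : ℕ → ℝ) (k : ℕ), i < k →
        (∀ k' < k, ∀ (X' : (domSys P M (k' + 1)).Dom), ∀ φ' ∈ sp k' X',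
          ‖termC S (k' + 1) X' (Function.update g i (t + d)) φ' - termC S (k' + 1) X' (Function.update g i t) φ'‖ ≤
              Real.exp (-(κ * (domSys P M (k' + 1)).dj X')) * D₁ (k' + 1) ∧
          ‖termC S (k' + 1) X' (Function.update g i t) φ' - termC S (k' + 1) X' (Function.update g i (t - d)) φ'‖ ≤
              Real.exp (-(κ * (domSys P M (k' + 1)).dj X')) * D₁ (k' + 1) ∧
          ‖termC S (k' + 1) X' (Function.update g i (t + d)) φ' - 2 * termC S (k' + 1) X' (Function.update g i t) φ' +
              termC S (k' + 1) X' (Function.update g i (t - d)) φ'‖ ≤ Real.exp (-(κ * (domSys P M (k' + 1)).dj X')) * D₂ (k' + 1)) →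
        ∀ (X : (domSys P M (k + 1)).Dom), ∀ φ ∈ sp k X,
          ‖termC S (k + 1) X (Function.update g i (t + d)) φ - 2 * termC S (k + 1) X (Function.update g i t) φ +
              termC S (k + 1) X (Function.update g i (t - d)) φ‖ ≤
            Real.exp (-(κ * (domSys P M (k + 1)).dj X)) * ∑ j ∈ range (k + 1), (a k j * D₂ j + b k j * D₁ j ^ 2))
    (ha : ∀ k j, j ≤ k → 0 ≤ a k j ∧ a k j ≤ c * ω₁ ^ (k - j)) (hb : ∀ k j, j ≤ k → 0 ≤ b k j ∧ b k j ≤ cb * ω₁ ^ (k - j))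
    (hlam₂ : ∀ k, lam₂ k ≤ ℓ₂) (hℓ₂ : 0 ≤ ℓ₂) (hc : 0 ≤ c) (hcb : 0 ≤ cb) (hω₁ : 0 ≤ ω₁) (hν : ω₁ + c < ν) (hμν : (ω₁ + c) ^ 2 ≤ ν) :
    ∀ g ∈ Window γ, ∀ (k i : ℕ), i < k + 1 → ∀ (t d : ℝ), 0 < d → t - d ∈ Ioc (0 : ℝ) γ → t + d ∈ Ioc (0 : ℝ) γ →
      ∀ (X : (domSys P M (k + 1)).Dom), ∀ φ ∈ sp k X,
        ‖termC S (k + 1) X (Function.update g i (t + d)) φ - 2 * termC S (k + 1) X (Function.update g i t) φ +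
            termC S (k + 1) X (Function.update g i (t - d)) φ‖ ≤
          max ℓ₂ (cb * ℓ₁ ^ 2 / (ν - ω₁ - c)) * ν ^ (k - i) * Real.exp (-(κ * (domSys P M (k + 1)).dj X)) * d ^ 2 := by
  obtain ⟨π, hπ, hπid⟩ := exists_proj sp hsp
  set E : Functional (histCarriers P M (RunPairing.single Unit)) (closedBall (0 : ℂ) 1 × CPair P 𝔸) :=
    fun g U X => ((U.1 : ℂ) * termC S X.1 X.2 g (π X U.2)).re with hEdef
  have hE : ∀ g U X, E g U X = ((U.1 : ℂ) * termC S X.1 X.2 g (π X U.2)).re := fun _ _ _ => rfl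
  -- (L1): ROAD 1 without smallness on `E♯`
  have hNE : NE9 E (BoxWindow (Ioc (0 : ℝ) γ)) κ (prodModuli ℓ₁ fun _ => ω₁ + c) :=
    ne9_of_stepLipschitz (scaleZeroFree_reTwist S _ π E hE _) (stepLipschitz_reTwist_of_term S _ sp π E hE hπ hπid hT1)
      (renewalSuper_geometric hℓ₁ hc hω₁ hlam fun k j hjk => (ha k j hjk).2)
  have hL1 : ∀ g ∈ Window γ, ∀ (U : closedBall (0 : ℂ) 1 × CPair P 𝔸) (X : (histCarriers P M (RunPairing.single Unit)).Dom) (i : ℕ),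
      i < (histCarriers P M (RunPairing.single Unit)).scale X → ∀ s ∈ Ioc (0 : ℝ) γ, ∀ s' ∈ Ioc (0 : ℝ) γ,
      |E (Function.update g i s) U X - E (Function.update g i s') U X| ≤
        Real.exp (-(κ * (histCarriers P M (RunPairing.single Unit)).d X)) * (ℓ₁ * (ω₁ + c) ^ ((histCarriers P M (RunPairing.single Unit)).scale X - 1 - i) * |s - s'|) := by
    intro g hg U X i hi s hs s' hs'
    have h := coordLipschitzOn_of_ne9 hNE U X g hg i hi s hs s' hs'
    rwa [prodModuli_const, if_pos hi] at h
  -- dag-n22-a's second-order recursion on `E♯`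
  have h2 := secondDiff_of_stepSecondDiff (prefixDependenceOn_reTwist S _ π E hE _) hL1 (secondDiffLast_reTwist_of_term S _ sp π E hE hπ hT2last)
    (secondDiffOld_reTwist_of_term S _ sp π E hE hπ hπid hT2old) ha hb hlam₂ hℓ₂ hc hcb hω₁ hν hμν
  -- read back in norm
  intro g hg k i hi t d hd hm hp X φ hφ
  have h := norm_secondDiff_termC_le_of_reTwist S _ sp π E hE hπid hφ fun u => h2 g hg (u, φ) ⟨k + 1, X⟩ i hi t d hd hm hp
  refine h.trans (le_of_eq ?_)
  rw [show k - i = k + 1 - 1 - i by rw [Nat.add_sub_cancel]]; rfl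

open Finset in
/-- ★★ **THE SAME IN THE BOX-HISTORY SHAPE OF J45∕J48∕J49's `hΔ`** (young couplings `g ∈ box γ k = ]0, γ]^{k+1}`, `i : Fin (k+1)`, the step-`k` datum `(S k).E`): under the inputs
of `termSecondDiff_of_termStepRecursion` and `0 < γ`, **`‖(S k).E(g∣g_i:=t+d) φ X − 2(S k).E(g∣g_i:=t) φ X + (S k).E(g∣g_i:=t−d) φ X‖ ≤ L₂·ν^{k−i}·e^{−κ d_{k+1}(X)}·d²`** —
extend the box history to a window history by `γ` and read `termC S (k+1) = (S k).E ∘ restrictPrefix k` (def-W1's `termC_succ`, J39's `histPrefix_update`). [folklore] -/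
theorem termSecondDiffAt_box_of_termStepRecursion (hsp : ∀ k X, (sp k X).Nonempty) {γ κ ℓ₁ ℓ₂ c cb ω₁ ν : ℝ} {lam lam₂ : ℕ → ℝ} {a b : ℕ → ℕ → ℝ}
    (hγ : 0 < γ)
    (hT1 : ∀ g ∈ Window γ, ∀ g' ∈ Window γ, ∀ (D : ℕ → ℝ) (k : ℕ),
      (∀ k' < k, ∀ (X' : (domSys P M (k' + 1)).Dom), ∀ φ' ∈ sp k' X',
        ‖termC S (k' + 1) X' g φ' - termC S (k' + 1) X' g' φ'‖ ≤ Real.exp (-(κ * (domSys P M (k' + 1)).dj X')) * D (k' + 1)) →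
      ∀ (X : (domSys P M (k + 1)).Dom), ∀ φ ∈ sp k X,
        ‖termC S (k + 1) X g φ - termC S (k + 1) X g' φ‖ ≤ Real.exp (-(κ * (domSys P M (k + 1)).dj X)) * (lam k * |g k - g' k| + ∑ j ∈ range (k + 1), a k j * D j))
    (hlam : ∀ k, lam k ≤ ℓ₁) (hℓ₁ : 0 ≤ ℓ₁)
    (hT2last : ∀ g ∈ Window γ, ∀ (k : ℕ) (t d : ℝ), 0 < d → t - d ∈ Ioc (0 : ℝ) γ → t + d ∈ Ioc (0 : ℝ) γ →
      ∀ (X : (domSys P M (k + 1)).Dom), ∀ φ ∈ sp k X,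
        ‖termC S (k + 1) X (Function.update g k (t + d)) φ - 2 * termC S (k + 1) X (Function.update g k t) φ +
            termC S (k + 1) X (Function.update g k (t - d)) φ‖ ≤ Real.exp (-(κ * (domSys P M (k + 1)).dj X)) * (lam₂ k * d ^ 2))
    (hT2old : ∀ g ∈ Window γ, ∀ (i : ℕ) (t d : ℝ), 0 < d → t - d ∈ Ioc (0 : ℝ) γ → t + d ∈ Ioc (0 : ℝ) γ →
      ∀ (D₁ D₂ : ℕ → ℝ) (k : ℕ), i < k →
        (∀ k' < k, ∀ (X' : (domSys P M (k' + 1)).Dom), ∀ φ' ∈ sp k' X',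
          ‖termC S (k' + 1) X' (Function.update g i (t + d)) φ' - termC S (k' + 1) X' (Function.update g i t) φ'‖ ≤
              Real.exp (-(κ * (domSys P M (k' + 1)).dj X')) * D₁ (k' + 1) ∧
          ‖termC S (k' + 1) X' (Function.update g i t) φ' - termC S (k' + 1) X' (Function.update g i (t - d)) φ'‖ ≤
              Real.exp (-(κ * (domSys P M (k' + 1)).dj X')) * D₁ (k' + 1) ∧
          ‖termC S (k' + 1) X' (Function.update g i (t + d)) φ' - 2 * termC S (k' + 1) X' (Function.update g i t) φ' +
              termC S (k' + 1) X' (Function.update g i (t - d)) φ'‖ ≤ Real.exp (-(κ * (domSys P M (k' + 1)).dj X')) * D₂ (k' + 1)) →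
        ∀ (X : (domSys P M (k + 1)).Dom), ∀ φ ∈ sp k X,
          ‖termC S (k + 1) X (Function.update g i (t + d)) φ - 2 * termC S (k + 1) X (Function.update g i t) φ +
              termC S (k + 1) X (Function.update g i (t - d)) φ‖ ≤
            Real.exp (-(κ * (domSys P M (k + 1)).dj X)) * ∑ j ∈ range (k + 1), (a k j * D₂ j + b k j * D₁ j ^ 2))
    (ha : ∀ k j, j ≤ k → 0 ≤ a k j ∧ a k j ≤ c * ω₁ ^ (k - j)) (hb : ∀ k j, j ≤ k → 0 ≤ b k j ∧ b k j ≤ cb * ω₁ ^ (k - j))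
    (hlam₂ : ∀ k, lam₂ k ≤ ℓ₂) (hℓ₂ : 0 ≤ ℓ₂) (hc : 0 ≤ c) (hcb : 0 ≤ cb) (hω₁ : 0 ≤ ω₁) (hν : ω₁ + c < ν) (hμν : (ω₁ + c) ^ 2 ≤ ν) :
    ∀ (k : ℕ) (i : Fin (k + 1)), ∀ g ∈ box γ k, ∀ (X : (domSys P M (k + 1)).Dom), ∀ φ ∈ sp k X, ∀ t d : ℝ, 0 < d →
      t - d ∈ Ioc (0 : ℝ) γ → t + d ∈ Ioc (0 : ℝ) γ →
        ‖(S k).E (Function.update g i (t + d)) φ X - 2 * (S k).E (Function.update g i t) φ X + (S k).E (Function.update g i (t - d)) φ X‖ ≤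
          max ℓ₂ (cb * ℓ₁ ^ 2 / (ν - ω₁ - c)) * ν ^ (k - (i : ℕ)) * Real.exp (-(κ * (domSys P M (k + 1)).dj X)) * d ^ 2 := by
  have hA := termSecondDiff_of_termStepRecursion S sp hsp hT1 hlam hℓ₁ hT2last hT2old ha hb hlam₂ hℓ₂ hc hcb hω₁ hν hμν
  intro k i gb hgb X φ hφ t d hd hm hp
  -- extend the box history to a window history by `γ`
  obtain ⟨g, hg⟩ : ∃ g : ℕ → ℝ, g = fun n => if h : n < k + 1 then gb ⟨n, h⟩ else γ := ⟨_, rfl⟩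
  have hgn : ∀ n (hn : n < k + 1), g n = gb ⟨n, hn⟩ := fun n hn => by rw [hg]; exact dif_pos hn
  have hres : Node00.U3OfKernels.histPrefix g k = gb := funext fun j => hgn j j.2
  have hgW : g ∈ Window γ := by
    intro n
    by_cases hn : n < k + 1
    · rw [hgn n hn]; exact hgb ⟨n, hn⟩
    · have e : g n = γ := by rw [hg]; exact dif_neg hn
      rw [e]; exact ⟨hγ, le_rfl⟩
  have key := hA g hgW k i i.2 t d hd hm hp X φ hφ
  have hr : ∀ s : ℝ, termC S (k + 1) X (Function.update g i s) φ = (S k).E (Function.update gb i s) φ X := fun s => by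
    rw [termC_succ, show restrictPrefix k (Function.update g (i : ℕ) s) = Node00.U3OfKernels.histPrefix (Function.update g (i : ℕ) s) k from rfl,
      histPrefix_update g k i.2, hres]
  rwa [hr, hr, hr] at key

end Term

end YMDAG.N22.TermRecursion

end
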